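import Mathlib
import HarnessLib
import Summits.HubbardSuperconductivity.HubbardSuperconductivity.Theorems.KLProgrammeKLRegimeUVCovarianceWeightedRowsAt
import Summits.HubbardSuperconductivity.HubbardSuperconductivity.Theorems.KLProgrammeKLRegimeTwoVolumeDataKit
import Summits.HubbardSuperconductivity.HubbardSuperconductivity.Theorems.KLProgrammeKLRegimeTwoVolumeProfileBridge

/-!
# Route `KLProgramme` — crux K3, child 4 VL (stmt-HubbardSuperconductivity-20440), located risk #8 «(VL)-DEAD-LEG»: the covariance data of
# the UV-dressed propagator `C^K_{>Λ}` at EVERY cutoff `0 < Λ ≤ klE0` — the two-volume kit's `(1 + tnorm)`-weighted rows/columns and the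
# far TAILS `≤ m₁/(R+1)`, on every time grid `N ≥ 2M`, uniform in `L` and `M`

Cell gate-hubbard-kl, seat hubbard-kl-k3c4-p2 g10 (pen rulings (R59t)(ii)/(R59u)/(R59aa); BGM 2006 (4.8b), `j = 1`).  Companion of
`…UVCovarianceMomentsAt` / `…UVCovarianceSpaceMomentAt` / `…UVCovarianceWeightedRowsAt`.  With
`G := (hubbardGridSub V M β N)ᵀ · hubbardCovAboveCT V M β μ 0 K Λ · hubbardGridSub V M β N`, `FrameOK R U N_sc μ K`, `R.WF`, `|U| ≤ 1`,
`klBetaMin ≤ β`, `β³ ≤ M`, `2M ≤ N`, cutoff derivatives `≤ B` up to order `5`, `0 < Λ ≤ klE0`: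

* **`rowSum_uvCov_one_add_tnorm_le`** / **`colSum_uvCov_one_add_tnorm_le`** — `Σ_Y ‖G X Y‖ · (1 + tnorm(x⃗_X − x⃗_Y)) ≤ (N/β)·(A₀(Λ) + 2·X_R(Λ))`
  (the `αw`-rows of k3c4-p1's `TwoVolumeDefect.sum_far_norm_le_of_weightedRow`, `…TwoVolumeDataKit`);
* **`farRowSum_uvCov_le`** / **`farColSum_uvCov_le`** — `Σ_{Y : R < tnorm(x⃗_X − x⃗_Y)} ‖G X Y‖ ≤ (N/β)·(A₀(Λ) + 2·X_R(Λ))/(R+1)`: the TAILS beyond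
  torus distance `R` vanish as `R → ∞` UNIFORMLY in `L`, `M`, `N` (the `τ`-data `hτ₁ … hτ₄` of
  `TwoVolumeDefect.sum_norm_kernel_map_sub_glue_map_le_of_defect` at `R ≍ L/(8n⋆)`).

`A₀(Λ)`, `X_R(Λ)` as in the companions (written out).  Everything is proved; no definitions, no named facts.
-/

noncomputable section

namespace Summit.HubbardSuperconductivity.HubbardSuperconductivity.Theorems.UVCovarianceAt

set_option linter.dupNamespace false -- summit = problem name (single-conjunct summit), D-0017

open Real Finset Literature.MathematicalPhysics.QuantumLattice Literature.Probability.LatticeModels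
open Literature.MathematicalPhysics.QuantumLattice.FermiRG
open Summit.HubbardSuperconductivity.HubbardSuperconductivity.Theorems.KLRegimeSplit
open Summit.HubbardSuperconductivity.HubbardSuperconductivity.Theorems.DispersionFlow
open Summit.HubbardSuperconductivity.HubbardSuperconductivity.Theorems.ScaleZeroDecay
open Summit.HubbardSuperconductivity.HubbardSuperconductivity.Theorems.EngineV8
open Summit.HubbardSuperconductivity.HubbardSuperconductivity.Theorems.TwoVolumeDefect

variable {L M N : ℕ} [NeZero L] [NeZero M] [NeZero N] {R : RenConsts} {U β μ Λ : ℝ} {Nsc : ℕ} {K : TrigPolyC4v} {B : ℝ}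

/-! ## §3 The two-volume kit's `(1 + tnorm)`-weighted rows/columns and the far TAILS -/

section Tails

/-- **`(1 + tnorm)`-weighted rows** (the `αw` of `TwoVolumeDefect.sum_far_norm_le_of_weightedRow`):
`Σ_Y ‖G X Y‖·(1 + tnorm(x⃗_X − x⃗_Y)) ≤ (N/β)·(A₀(Λ) + 2·X_R(Λ))`. -/
theorem rowSum_uvCov_one_add_tnorm_le (hK : FrameOK R U Nsc μ K) (hR : R.WF) (hU1 : |U| ≤ 1) (hβ : klBetaMin ≤ β) (hβM : β ^ 3 ≤ (M : ℝ))
    (hMN : 2 * M ≤ N) (hB1 : 1 ≤ B) (hB : ∀ i ≤ 5, ∀ t, ‖iteratedDeriv i salmhoferCutoff t‖ ≤ B) (hΛ : 0 < Λ) (hΛe : Λ ≤ klE0)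
    (X : GridLeg (GridPoint L N)) :
    ∑ Y : GridLeg (GridPoint L N),
        ‖((hubbardGridSub L M β N).transpose * hubbardCovAboveCT L M β μ 0 K Λ * hubbardGridSub L M β N) X Y‖ *
          (1 + (Torus.tnorm (X.1.1.2 - Y.1.1.2) : ℝ)) ≤
      (N : ℝ) / β *
        (14 * Real.sqrt ((1 / 2 + 12 / Λ) *
            (2 / Λ + 128 * Real.pi ^ 4 * (4 * (1110 : ℝ) + 6 * (32 / 3) + 2) ^ 2 / Λ +
              2 * Real.pi ^ 5 * (4 * (1110 : ℝ) + 6 * (32 / 3) + 2) ^ 2 / Λ ^ 2 + 1 +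
              Real.pi ^ 4 * ((7 : ℝ) ^ 2 * (4 * (1110 : ℝ) + 6 * (32 / 3) + 2) * (2 / Λ) + 7 * (2 * (32 / 3) + 1)) ^ 2 / Λ ^ 3)) +
          2 * (uvSpaceMomentConst Λ 1 (uvPieceSq Λ (uvBaseQ B Λ 4) (uvBaseQ' B Λ 4)) +
            (1 / 4 * Real.sqrt (216 * (1 / Λ + 1 / 2)) *
                ∑ e : Fin 2 × Fin 2, (uvLinV Λ (1 + (e.1 : ℕ) + (e.2 : ℕ)) *
                    (B * ((1 + ((e.1 : ℕ) + (e.2 : ℕ)) + 2).factorial : ℝ) * (4 / Λ) ^ (1 + ((e.1 : ℕ) + (e.2 : ℕ)) + 1)) +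
                  uvLinD Λ (1 + (e.1 : ℕ) + (e.2 : ℕ)) *
                    (B * ((1 + ((e.1 : ℕ) + (e.2 : ℕ)) + 3).factorial : ℝ) * (4 / Λ) ^ (1 + ((e.1 : ℕ) + (e.2 : ℕ)) + 2)))) *
              (4608 * (1 + R.Gfr 0 + R.Gfr 1 + R.Gfr 2 + R.Gfr 3) ^ 4 * (((Nsc : ℝ) + 1) * U ^ 2 + 2 * |U|)))) := by
  have hβ0 : 0 < β := beta_pos_of_klBetaMin_le hβ
  set A0 : ℝ := 14 * Real.sqrt ((1 / 2 + 12 / Λ) *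
            (2 / Λ + 128 * Real.pi ^ 4 * (4 * (1110 : ℝ) + 6 * (32 / 3) + 2) ^ 2 / Λ +
              2 * Real.pi ^ 5 * (4 * (1110 : ℝ) + 6 * (32 / 3) + 2) ^ 2 / Λ ^ 2 + 1 +
              Real.pi ^ 4 * ((7 : ℝ) ^ 2 * (4 * (1110 : ℝ) + 6 * (32 / 3) + 2) * (2 / Λ) + 7 * (2 * (32 / 3) + 1)) ^ 2 / Λ ^ 3)) with hA0
  set XR : ℝ := uvSpaceMomentConst Λ 1 (uvPieceSq Λ (uvBaseQ B Λ 4) (uvBaseQ' B Λ 4)) +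
            (1 / 4 * Real.sqrt (216 * (1 / Λ + 1 / 2)) *
                ∑ e : Fin 2 × Fin 2, (uvLinV Λ (1 + (e.1 : ℕ) + (e.2 : ℕ)) *
                    (B * ((1 + ((e.1 : ℕ) + (e.2 : ℕ)) + 2).factorial : ℝ) * (4 / Λ) ^ (1 + ((e.1 : ℕ) + (e.2 : ℕ)) + 1)) +
                  uvLinD Λ (1 + (e.1 : ℕ) + (e.2 : ℕ)) *
                    (B * ((1 + ((e.1 : ℕ) + (e.2 : ℕ)) + 3).factorial : ℝ) * (4 / Λ) ^ (1 + ((e.1 : ℕ) + (e.2 : ℕ)) + 2)))) *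
              (4608 * (1 + R.Gfr 0 + R.Gfr 1 + R.Gfr 2 + R.Gfr 3) ^ 4 * (((Nsc : ℝ) + 1) * U ^ 2 + 2 * |U|)) with hXR
  set G := (hubbardGridSub L M β N).transpose * hubbardCovAboveCT L M β μ 0 K Λ * hubbardGridSub L M β N with hGdef
  have hplain : ∑ Y : GridLeg (GridPoint L N), ‖G X Y‖ ≤ (N : ℝ) / β * A0 := rowSum_uvCov_le (L := L) hK hβ hβM hΛ hΛe hMN X
  have hXsum : ∀ σ : Fin 2, ∑ a : TorusSite 1 N, ∑ bv : TorusSite 2 L,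
      torusSiteDist bv 0 * ‖∑ q₀ : TorusSite 1 N, ∑ qv : TorusSite 2 L, torusChar q₀ a * torusChar qv bv *
        gridSymbol L M N β (uvSymbolCT L M β μ K Λ) σ q₀ qv‖ ≤ (N : ℝ) / β * (2 * XR) :=
    torusSum_uvCov_spaceWt_le (L := L) hK hR hU1 hβ hβM hMN hB1 hB hΛ hΛe
  have hspace : ∑ Y : GridLeg (GridPoint L N), ‖G X Y‖ * torusSiteDist (X.1.1.2 - Y.1.1.2) 0 ≤ (N : ℝ) / β * (2 * XR) := by
    have h := sum_norm_mul_gridSub_pullback_row_le_of_weight (L := L) (M := M) (N := N) hβ0.ne' hMN (uvSymbolCT L M β μ K Λ)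
      (fun _ bv => torusSiteDist bv 0) (fun a bv => by simp only [torusSiteDist_neg_zero]) hXsum X
    rw [hGdef, hubbardCovAboveCT_zero_seed_eq_normalCovariance_uvSymbolCT]
    simpa only using h
  have hsplit : ∀ Y : GridLeg (GridPoint L N), ‖G X Y‖ * (1 + (Torus.tnorm (X.1.1.2 - Y.1.1.2) : ℝ)) =
      ‖G X Y‖ + ‖G X Y‖ * torusSiteDist (X.1.1.2 - Y.1.1.2) 0 := by
    intro Y
    rw [tnorm_sub_eq_torusSiteDist, torusSiteDist_eq_sub_zero X.1.1.2]
    ring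
  rw [sum_congr rfl fun Y _ => hsplit Y, sum_add_distrib, mul_add]
  exact add_le_add hplain hspace

/-- **`(1 + tnorm)`-weighted columns.** -/
theorem colSum_uvCov_one_add_tnorm_le (hK : FrameOK R U Nsc μ K) (hR : R.WF) (hU1 : |U| ≤ 1) (hβ : klBetaMin ≤ β) (hβM : β ^ 3 ≤ (M : ℝ))
    (hMN : 2 * M ≤ N) (hB1 : 1 ≤ B) (hB : ∀ i ≤ 5, ∀ t, ‖iteratedDeriv i salmhoferCutoff t‖ ≤ B) (hΛ : 0 < Λ) (hΛe : Λ ≤ klE0)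
    (Y : GridLeg (GridPoint L N)) :
    ∑ X : GridLeg (GridPoint L N),
        ‖((hubbardGridSub L M β N).transpose * hubbardCovAboveCT L M β μ 0 K Λ * hubbardGridSub L M β N) X Y‖ *
          (1 + (Torus.tnorm (X.1.1.2 - Y.1.1.2) : ℝ)) ≤
      (N : ℝ) / β *
        (14 * Real.sqrt ((1 / 2 + 12 / Λ) *
            (2 / Λ + 128 * Real.pi ^ 4 * (4 * (1110 : ℝ) + 6 * (32 / 3) + 2) ^ 2 / Λ +
              2 * Real.pi ^ 5 * (4 * (1110 : ℝ) + 6 * (32 / 3) + 2) ^ 2 / Λ ^ 2 + 1 +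
              Real.pi ^ 4 * ((7 : ℝ) ^ 2 * (4 * (1110 : ℝ) + 6 * (32 / 3) + 2) * (2 / Λ) + 7 * (2 * (32 / 3) + 1)) ^ 2 / Λ ^ 3)) +
          2 * (uvSpaceMomentConst Λ 1 (uvPieceSq Λ (uvBaseQ B Λ 4) (uvBaseQ' B Λ 4)) +
            (1 / 4 * Real.sqrt (216 * (1 / Λ + 1 / 2)) *
                ∑ e : Fin 2 × Fin 2, (uvLinV Λ (1 + (e.1 : ℕ) + (e.2 : ℕ)) *
                    (B * ((1 + ((e.1 : ℕ) + (e.2 : ℕ)) + 2).factorial : ℝ) * (4 / Λ) ^ (1 + ((e.1 : ℕ) + (e.2 : ℕ)) + 1)) +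
                  uvLinD Λ (1 + (e.1 : ℕ) + (e.2 : ℕ)) *
                    (B * ((1 + ((e.1 : ℕ) + (e.2 : ℕ)) + 3).factorial : ℝ) * (4 / Λ) ^ (1 + ((e.1 : ℕ) + (e.2 : ℕ)) + 2)))) *
              (4608 * (1 + R.Gfr 0 + R.Gfr 1 + R.Gfr 2 + R.Gfr 3) ^ 4 * (((Nsc : ℝ) + 1) * U ^ 2 + 2 * |U|)))) := by
  have hβ0 : 0 < β := beta_pos_of_klBetaMin_le hβ
  set A0 : ℝ := 14 * Real.sqrt ((1 / 2 + 12 / Λ) *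
            (2 / Λ + 128 * Real.pi ^ 4 * (4 * (1110 : ℝ) + 6 * (32 / 3) + 2) ^ 2 / Λ +
              2 * Real.pi ^ 5 * (4 * (1110 : ℝ) + 6 * (32 / 3) + 2) ^ 2 / Λ ^ 2 + 1 +
              Real.pi ^ 4 * ((7 : ℝ) ^ 2 * (4 * (1110 : ℝ) + 6 * (32 / 3) + 2) * (2 / Λ) + 7 * (2 * (32 / 3) + 1)) ^ 2 / Λ ^ 3)) with hA0
  set XR : ℝ := uvSpaceMomentConst Λ 1 (uvPieceSq Λ (uvBaseQ B Λ 4) (uvBaseQ' B Λ 4)) +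
            (1 / 4 * Real.sqrt (216 * (1 / Λ + 1 / 2)) *
                ∑ e : Fin 2 × Fin 2, (uvLinV Λ (1 + (e.1 : ℕ) + (e.2 : ℕ)) *
                    (B * ((1 + ((e.1 : ℕ) + (e.2 : ℕ)) + 2).factorial : ℝ) * (4 / Λ) ^ (1 + ((e.1 : ℕ) + (e.2 : ℕ)) + 1)) +
                  uvLinD Λ (1 + (e.1 : ℕ) + (e.2 : ℕ)) *
                    (B * ((1 + ((e.1 : ℕ) + (e.2 : ℕ)) + 3).factorial : ℝ) * (4 / Λ) ^ (1 + ((e.1 : ℕ) + (e.2 : ℕ)) + 2)))) *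
              (4608 * (1 + R.Gfr 0 + R.Gfr 1 + R.Gfr 2 + R.Gfr 3) ^ 4 * (((Nsc : ℝ) + 1) * U ^ 2 + 2 * |U|)) with hXR
  set G := (hubbardGridSub L M β N).transpose * hubbardCovAboveCT L M β μ 0 K Λ * hubbardGridSub L M β N with hGdef
  have hplain : ∑ X : GridLeg (GridPoint L N), ‖G X Y‖ ≤ (N : ℝ) / β * A0 := colSum_uvCov_le (L := L) hK hβ hβM hΛ hΛe hMN Y
  have hXsum : ∀ σ : Fin 2, ∑ a : TorusSite 1 N, ∑ bv : TorusSite 2 L,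
      torusSiteDist bv 0 * ‖∑ q₀ : TorusSite 1 N, ∑ qv : TorusSite 2 L, torusChar q₀ a * torusChar qv bv *
        gridSymbol L M N β (uvSymbolCT L M β μ K Λ) σ q₀ qv‖ ≤ (N : ℝ) / β * (2 * XR) :=
    torusSum_uvCov_spaceWt_le (L := L) hK hR hU1 hβ hβM hMN hB1 hB hΛ hΛe
  have hspace : ∑ X : GridLeg (GridPoint L N), ‖G X Y‖ * torusSiteDist (X.1.1.2 - Y.1.1.2) 0 ≤ (N : ℝ) / β * (2 * XR) := by
    have h := sum_norm_mul_gridSub_pullback_col_le_of_weight (L := L) (M := M) (N := N) hβ0.ne' hMN (uvSymbolCT L M β μ K Λ)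
      (fun _ bv => torusSiteDist bv 0) (fun a bv => by simp only [torusSiteDist_neg_zero]) hXsum Y
    rw [hGdef, hubbardCovAboveCT_zero_seed_eq_normalCovariance_uvSymbolCT]
    simpa only using h
  have hsplit : ∀ X : GridLeg (GridPoint L N), ‖G X Y‖ * (1 + (Torus.tnorm (X.1.1.2 - Y.1.1.2) : ℝ)) =
      ‖G X Y‖ + ‖G X Y‖ * torusSiteDist (X.1.1.2 - Y.1.1.2) 0 := by
    intro X
    rw [tnorm_sub_eq_torusSiteDist, torusSiteDist_eq_sub_zero X.1.1.2]
    ring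
  rw [sum_congr rfl fun X _ => hsplit X, sum_add_distrib, mul_add]
  exact add_le_add hplain hspace

/-- **The far ROW tails vanish uniformly in the volume**: for every radius `Rfar`,
`Σ_{Y : Rfar < tnorm(x⃗_X − x⃗_Y)} ‖G X Y‖ ≤ (N/β)·(A₀(Λ) + 2·X_R(Λ))/(Rfar + 1)` — free of `L`, `M` (BGM (4.8b) `j = 1` ⇒ tails `≲ Λ⁻²/R`). -/
theorem farRowSum_uvCov_le (hK : FrameOK R U Nsc μ K) (hR : R.WF) (hU1 : |U| ≤ 1) (hβ : klBetaMin ≤ β) (hβM : β ^ 3 ≤ (M : ℝ))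
    (hMN : 2 * M ≤ N) (hB1 : 1 ≤ B) (hB : ∀ i ≤ 5, ∀ t, ‖iteratedDeriv i salmhoferCutoff t‖ ≤ B) (hΛ : 0 < Λ) (hΛe : Λ ≤ klE0)
    (Rfar : ℕ) (X : GridLeg (GridPoint L N)) :
    ∑ Y ∈ univ.filter (fun Y : GridLeg (GridPoint L N) => Rfar < Torus.tnorm (X.1.1.2 - Y.1.1.2)),
        ‖((hubbardGridSub L M β N).transpose * hubbardCovAboveCT L M β μ 0 K Λ * hubbardGridSub L M β N) X Y‖ ≤
      (N : ℝ) / β *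
        (14 * Real.sqrt ((1 / 2 + 12 / Λ) *
            (2 / Λ + 128 * Real.pi ^ 4 * (4 * (1110 : ℝ) + 6 * (32 / 3) + 2) ^ 2 / Λ +
              2 * Real.pi ^ 5 * (4 * (1110 : ℝ) + 6 * (32 / 3) + 2) ^ 2 / Λ ^ 2 + 1 +
              Real.pi ^ 4 * ((7 : ℝ) ^ 2 * (4 * (1110 : ℝ) + 6 * (32 / 3) + 2) * (2 / Λ) + 7 * (2 * (32 / 3) + 1)) ^ 2 / Λ ^ 3)) +
          2 * (uvSpaceMomentConst Λ 1 (uvPieceSq Λ (uvBaseQ B Λ 4) (uvBaseQ' B Λ 4)) +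
            (1 / 4 * Real.sqrt (216 * (1 / Λ + 1 / 2)) *
                ∑ e : Fin 2 × Fin 2, (uvLinV Λ (1 + (e.1 : ℕ) + (e.2 : ℕ)) *
                    (B * ((1 + ((e.1 : ℕ) + (e.2 : ℕ)) + 2).factorial : ℝ) * (4 / Λ) ^ (1 + ((e.1 : ℕ) + (e.2 : ℕ)) + 1)) +
                  uvLinD Λ (1 + (e.1 : ℕ) + (e.2 : ℕ)) *
                    (B * ((1 + ((e.1 : ℕ) + (e.2 : ℕ)) + 3).factorial : ℝ) * (4 / Λ) ^ (1 + ((e.1 : ℕ) + (e.2 : ℕ)) + 2)))) *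
              (4608 * (1 + R.Gfr 0 + R.Gfr 1 + R.Gfr 2 + R.Gfr 3) ^ 4 * (((Nsc : ℝ) + 1) * U ^ 2 + 2 * |U|)))) / ((Rfar : ℝ) + 1) :=
  sum_far_norm_le_of_weightedRow _ Rfar X (rowSum_uvCov_one_add_tnorm_le hK hR hU1 hβ hβM hMN hB1 hB hΛ hΛe X)

/-- **The far COLUMN tails**: `Σ_{X : Rfar < tnorm(x⃗_X − x⃗_Y)} ‖G X Y‖ ≤ (N/β)·(A₀(Λ) + 2·X_R(Λ))/(Rfar + 1)`. -/
theorem farColSum_uvCov_le (hK : FrameOK R U Nsc μ K) (hR : R.WF) (hU1 : |U| ≤ 1) (hβ : klBetaMin ≤ β) (hβM : β ^ 3 ≤ (M : ℝ))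
    (hMN : 2 * M ≤ N) (hB1 : 1 ≤ B) (hB : ∀ i ≤ 5, ∀ t, ‖iteratedDeriv i salmhoferCutoff t‖ ≤ B) (hΛ : 0 < Λ) (hΛe : Λ ≤ klE0)
    (Rfar : ℕ) (Y : GridLeg (GridPoint L N)) :
    ∑ X ∈ univ.filter (fun X : GridLeg (GridPoint L N) => Rfar < Torus.tnorm (X.1.1.2 - Y.1.1.2)),
        ‖((hubbardGridSub L M β N).transpose * hubbardCovAboveCT L M β μ 0 K Λ * hubbardGridSub L M β N) X Y‖ ≤
      (N : ℝ) / β *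
        (14 * Real.sqrt ((1 / 2 + 12 / Λ) *
            (2 / Λ + 128 * Real.pi ^ 4 * (4 * (1110 : ℝ) + 6 * (32 / 3) + 2) ^ 2 / Λ +
              2 * Real.pi ^ 5 * (4 * (1110 : ℝ) + 6 * (32 / 3) + 2) ^ 2 / Λ ^ 2 + 1 +
              Real.pi ^ 4 * ((7 : ℝ) ^ 2 * (4 * (1110 : ℝ) + 6 * (32 / 3) + 2) * (2 / Λ) + 7 * (2 * (32 / 3) + 1)) ^ 2 / Λ ^ 3)) +
          2 * (uvSpaceMomentConst Λ 1 (uvPieceSq Λ (uvBaseQ B Λ 4) (uvBaseQ' B Λ 4)) +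
            (1 / 4 * Real.sqrt (216 * (1 / Λ + 1 / 2)) *
                ∑ e : Fin 2 × Fin 2, (uvLinV Λ (1 + (e.1 : ℕ) + (e.2 : ℕ)) *
                    (B * ((1 + ((e.1 : ℕ) + (e.2 : ℕ)) + 2).factorial : ℝ) * (4 / Λ) ^ (1 + ((e.1 : ℕ) + (e.2 : ℕ)) + 1)) +
                  uvLinD Λ (1 + (e.1 : ℕ) + (e.2 : ℕ)) *
                    (B * ((1 + ((e.1 : ℕ) + (e.2 : ℕ)) + 3).factorial : ℝ) * (4 / Λ) ^ (1 + ((e.1 : ℕ) + (e.2 : ℕ)) + 2)))) *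
              (4608 * (1 + R.Gfr 0 + R.Gfr 1 + R.Gfr 2 + R.Gfr 3) ^ 4 * (((Nsc : ℝ) + 1) * U ^ 2 + 2 * |U|)))) / ((Rfar : ℝ) + 1) := by
  have h := sum_filter_le_div_of_weight univ
    (fun X => ‖((hubbardGridSub L M β N).transpose * hubbardCovAboveCT L M β μ 0 K Λ * hubbardGridSub L M β N) X Y‖)
    (fun X : GridLeg (GridPoint L N) => Torus.tnorm (X.1.1.2 - Y.1.1.2)) (fun _ _ => norm_nonneg _) Rfar
  refine h.trans ?_
  rw [div_eq_inv_mul]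
  refine mul_le_mul_of_nonneg_left (le_trans (sum_le_sum fun X _ => ?_) (colSum_uvCov_one_add_tnorm_le hK hR hU1 hβ hβM hMN hB1 hB hΛ hΛe Y))
    (by positivity)
  nlinarith [norm_nonneg (((hubbardGridSub L M β N).transpose * hubbardCovAboveCT L M β μ 0 K Λ * hubbardGridSub L M β N) X Y),
    (Nat.cast_nonneg (Torus.tnorm (X.1.1.2 - Y.1.1.2)) : (0 : ℝ) ≤ _)]

end Tails

end Summit.HubbardSuperconductivity.HubbardSuperconductivity.Theorems.UVCovarianceAt

end
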